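import Summits.AtomisticToContinuum.FouriersLaw.Theorems.OddSectorIrreversibilityTapLeakBoundHermiteOfMixedTap
import Summits.AtomisticToContinuum.FouriersLaw.Theorems.OddSectorIrreversibilityTapLeakBoundKickCone
import Summits.AtomisticToContinuum.FouriersLaw.Theorems.OddSectorIrreversibilityTapLeakBoundPositionTapGlue

/-!
# Skeleton line `SketchIdeator2` for crux `TapLeakBound` (P, stmt-AtomisticToContinuum-15159) — lead c3, v11c (registered session 3; header refreshed after the third floor landed)

Route `OddSectorIrreversibility` (sub-problem `FouriersLaw`), crux P = `TapLeakBound` (rank 4).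

## State (v11, lead c3 session A, 2026-08-17: CORRECTOR SIDE RESHAPED — M ∧ D replaced by the single first-order stub PTB)

The composition is LANDED end to end (`tapLeakBound_of_mixedTapBound_of_kickCone`, p126684, on
`tapLeakBound_of_hermite_of_kickCone`, p122261). v9/v10 fed its corrector input `MixedTapBound` from TWO registered stubs,
(M) `stub_partialQMem` (FIXED `N`: `∂_{q_b}u ∈ L²(μ_T)`; blocked on a missing QUANTITATIVE interior subelliptic C¹ estimate for
`L = X_L² + X_R² + Y` — the tree's Hörmander theorem is qualitative) and (D) `stub_hessianDrive` (`N`-UNIFORM Hessian-drive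
budget `‖G_b‖² ≤ C(|⟨u,J⟩|+Z)`, SECOND order: `G_b = L(∂_{q_b}u) + ∂_{q_b}J`), through the landed overdamped-resolvent reduction
p128400. Lead c3's wave found (and landed, p140030 `…TapLeakBoundPositionTapGlue.lean`) that the consumer needs strictly less:
the `N`-uniform POSITION TAP BUDGET

  (PTB) `∂_{q_b}u ∈ L²(μ_T)` and `‖∂_{q_b}u‖²_{L²(μ_T)} ≤ C (|⟨u,J⟩_{μ_T}| + Z)`, `C` independent of `N`,

already gives `MixedTapBound` verbatim by Cauchy–Schwarz and the landed tap energy identity `γT‖∂_{p_b}u‖² ≤ ⟨u,J⟩`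
(`stub_mixedTapOfPositionTap` = `mixedTapBound_of_positionTapBudget`, p140030), while conversely (M ∧ D) ⇒ PTB over the landed
overdamped calculus (worker file `work/stubs/stub_hessianDrive_positionTapB.lean`, rc 0, to land as documentation). Hence v11
registers exactly TWO stubs, both honest `N`-uniform bets and nothing fixed-`N`:

* `stub_positionTapBudget` (PTB; corrector side, FIRST order, ONE commutator from the noise: `[∂_{p_b}, L] = ∂_{q_b} − γ∂_{p_b}`;
  its fixed-`N` membership half is the old M; harmonic member exact; card drain-convexity R_q ratios 4–10 flat in `N ≤ 64`);
* `stub_kickCone` (F = C′, flow side: the `N`-uniform LINEAR-window `L²(Gibbs)` light cone of the closed chain; unchanged since v5;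
  cap p126451 and deterministic block cone p134884…p136977 landed; its SUB-linear FLOOR — the same statement with window
  `s⁴ ≤ a(1+d)³` and profile `(1+d)^{-3}` — is LANDED (`stub_floorKickCone`, p140638, over `…TapLeakBoundFloor*.lean`
  p138693…p140560, lead c3 session B); its SECOND FLOOR — EVERY POWER window `s^{4m₀} ≤ a(1+d)^{4m₀-1}`, `m₀ ≥ 1`
  (exponent `1 − 1/(4m₀) → 1`), same bound — is LANDED too (lead c3 session 3: sup-in-time maximal inequality p140964,
  window arithmetic p141228, core p142076, stub spelling `stub_floorSupKickCone` p142696), PTB ALONE gives the crux's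
  inequality in every power window (`stub_powWindowTapLeak`, p143524), and its THIRD FLOOR — the LOG window
  `s(1 + log(1+d)) ≤ a·d`, from quantitative Gibbs moments `K^m(m!)²` (p144774) and the log sup tail (p144834) — is landed as
  well (core p145189, stub spelling `stub_floorLogKickCone` p145336); the linear window itself is out of reach of every
  energy-truncation argument (a cap bounded in `d` fails with Gibbs probability `↛ 0`) and of every path-sum argument
  (`cosh` for `cos`): what is missing is the pair (D) two-speed deterministic cone + (S) space-time Chernoff "no surfing" bound
  of `MEMO-linear-window.md` on the item).

`sorry` lives ONLY in these two.

## History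
v10 (c3): v9 re-registered, stubs {M, D, F}. v9 (c2): wave-1 landed p127968/p128187/p128400 (MixedTapBound ⇐ M ∧ D). v8/v7 (c1/c2):
everything fixed-`N` of the H1 bookkeeping LANDED — lead 0 (line `Sketch`): p101997 p102157 p121225 p122261; lead c1: p124190 p125484
p126011 p126050 p126451 p126684.

## Disproof used
`Cruxes/TapLeakBound/Disproof.lean` v4 (cdisprove): §1 time parity (pairing odd in `s`; `s = 0`, `d = 0`, `N ≤ 2` content-free) —
consistent, both stubs have their content at `s ≍ d` / in the bulk response; §4 `tapLeakBound_false_without_corrector` — every proof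
must extract the `√(|⟨u,J⟩|+Z)` normalisation from `Lu = −J`: here through the tap identity (inside `hermite_core` and
`mixedTap_of_positionTap_core`) and through PTB itself; §2 receivers (capped-cone tail of order `1/(αT)` under an EXPONENTIAL precursor
and Arrhenius lifetimes) threaten exactly F — the deterministic block cone gives a SUPER-exponential precursor `(eΛs/d)^d` on the cold
event, against which a receiver of fixed gain rate loses at large `d`; kit j022104 (this cycle) measures the precursor law at
`T = 1…40` and a planted receiver. `-- Targets`: none posted for this line yet.
-/

noncomputable section

open MeasureTheory ProbabilityTheory Filter Topology Set Function
open scoped NNReal ENNReal ContDiff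

namespace Summit.AtomisticToContinuum.FouriersLaw.Theorems.OddSectorIrreversibility.TapLeak

open Literature.MathematicalPhysics.KineticTheory.HeatConduction
open Literature.MathematicalPhysics.KineticTheory
open Summit.AtomisticToContinuum.FouriersLaw.Theses.OddSectorIrreversibility (TapLeakBound)
open Summit.AtomisticToContinuum.FouriersLaw.Theorems.OddSectorWitness
open Summit.AtomisticToContinuum.FouriersLaw.Theorems.OddSectorIrreversibility.Corrector

/-! ### Registered stubs (`sorry` lives ONLY here) -/

/-- STUB PTB `stub_positionTapBudget` (the `N`-UNIFORM corrector-side bet of the line since v11; replaces M ∧ D of v9/v10, which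
imply it — `work/stubs/stub_hessianDrive_positionTapB.lean` — and which it replaces as the ONLY input of `MixedTapBound`, p140030).
For `u` exactly as in `TapLeakBound` (the `C¹ ∩ L²(μ_T)` a.e.-limit of the finite-horizon Kubo correctors, hence the smooth classical
corrector with `L u = −J` by `stub_correctorSmooth`) and a contact `b`: the contact POSITION derivative is square integrable and obeys the
tap-scale budget `∫ (∂_{q_b}u)² dμ_T ≤ C (|∫ u J dμ_T| + Z)` with `C = C(ω₂, lam, β, γ, T)` independent of `N` (the momentum analogue
`γT ∫(∂_{p_b}u)² dμ_T ≤ ∫ uJ dμ_T` is the landed tap identity; PTB says a position kick at the contact is absorbed on the same scale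
as a momentum kick). [conjecture of the route] -/
theorem stub_positionTapBudget : ∀ ω₂ lam β γ : ℝ, 0 < ω₂ → 0 < lam → 0 < β → 0 < γ → ∀ T : ℝ, 0 < T → ∃ C : ℝ, ∀ (N : ℕ) (b : Fin N) (u : PhaseSpace N → ℝ), (b.val = 0 ∨ b.val = N - 1) → ContDiff ℝ 1 u → MemLp u 2 (gibbsWeight ω₂ lam β γ N T) → (∀ᵐ x ∂(gibbsWeight ω₂ lam β γ N T), Tendsto (fun τ : ℝ => ∫ t in Set.Ioc (0 : ℝ) τ, (∫ y, (∑ k : Fin N, (pinnedChain ω₂ lam β γ).bondCurrent N k y) ∂((pinnedChain ω₂ lam β γ).transitionKernel N T T t.toNNReal x))) atTop (𝓝 (u x))) → MemLp (partialQ b u) 2 (gibbsWeight ω₂ lam β γ N T) ∧ ∫ x, (partialQ b u x) ^ 2 ∂(gibbsWeight ω₂ lam β γ N T) ≤ C * (|∫ x, u x * (∑ k : Fin N, (pinnedChain ω₂ lam β γ).bondCurrent N k x) ∂(gibbsWeight ω₂ lam β γ N T)| + ∫ x, Real.exp (-((pinnedChain ω₂ lam β γ).hamiltonian N x) / T) ∂volume)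 := by
  sorry

/-- **MixedTapBound, PROVED from stub PTB** (the statement is the registered `stub_mixedTap` of v7/v8, verbatim): by the landed
glue `stub_mixedTapOfPositionTap` (p140030: Cauchy–Schwarz + tap energy identity). [folklore] -/
theorem stub_mixedTap_of : ∀ ω₂ lam β γ : ℝ, 0 < ω₂ → 0 < lam → 0 < β → 0 < γ → ∀ T : ℝ, 0 < T →
    ∃ C : ℝ, ∀ (N : ℕ) (b : Fin N) (u : PhaseSpace N → ℝ), (b.val = 0 ∨ b.val = N - 1) →
      ContDiff ℝ 1 u → MemLp u 2 (gibbsWeight ω₂ lam β γ N T) →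
      (∀ᵐ x ∂(gibbsWeight ω₂ lam β γ N T), Tendsto (fun τ : ℝ => ∫ t in Set.Ioc (0 : ℝ) τ,
          (∫ y, (∑ k : Fin N, (pinnedChain ω₂ lam β γ).bondCurrent N k y)
            ∂((pinnedChain ω₂ lam β γ).transitionKernel N T T t.toNNReal x))) atTop (𝓝 (u x))) →
        MemLp (partialQ b u) 2 (gibbsWeight ω₂ lam β γ N T) ∧
        T * ∫ x, partialQ b u x * partialP b u x ∂(gibbsWeight ω₂ lam β γ N T) ≤
          C * (|∫ x, u x * (∑ k : Fin N, (pinnedChain ω₂ lam β γ).bondCurrent N k x) ∂(gibbsWeight ω₂ lam β γ N T)| +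
            ∫ x, Real.exp (-((pinnedChain ω₂ lam β γ).hamiltonian N x) / T) ∂volume) :=
  stub_mixedTapOfPositionTap stub_positionTapBudget

/-- STUB F `stub_kickCone` = C′ `ResampledKickCone` (`N`-UNIFORM BET of the line on the flow side; statement unchanged
from v5, `let`-free spelling since v7b so that the registered header is the full signature). CAPPED resampling differences of the transported current: there are `a > 0`, `C` such that for every `N`, bond
`i`, contact `b` (distance `d`), `0 ≤ s ≤ a·d`:
`∫ ∫ (j_i(Φ_s(q, p[b ↦ p'])) − j_i(Φ_s(q,p)))² dN(0,T)(p') dμ_T(q,p) ≤ C · Z · (1 + d − s/a)^{-3}`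
(`Φ_s` written as the zero-friction kernels, as in P). [conjecture of the route] -/
theorem stub_kickCone : ∀ ω₂ lam β γ : ℝ, 0 < ω₂ → 0 < lam → 0 < β → 0 < γ → ∀ T : ℝ, 0 < T →
    ∃ a C : ℝ, 0 < a ∧ ∀ (N : ℕ) (i b : Fin N) (s : ℝ), (b.val = 0 ∨ b.val = N - 1) → 0 ≤ s →
      s ≤ a * ((if b.val = 0 then i.val else N - 2 - i.val : ℕ) : ℝ) →
        ∫ x, (∫ p', ((∫ y, (pinnedChain ω₂ lam β γ).bondCurrent N i y
              ∂((pinnedChain ω₂ lam β 0).transitionKernel N T T s.toNNReal (x.1, Function.update x.2 b p'))) -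
            (∫ y, (pinnedChain ω₂ lam β γ).bondCurrent N i y
              ∂((pinnedChain ω₂ lam β 0).transitionKernel N T T s.toNNReal x))) ^ 2
            ∂(gaussianReal 0 (Real.toNNReal T))) ∂(gibbsWeight ω₂ lam β γ N T)
          ≤ C * (∫ x, Real.exp (-((pinnedChain ω₂ lam β γ).hamiltonian N x) / T) ∂volume) /
              (1 + (((if b.val = 0 then i.val else N - 2 - i.val : ℕ) : ℝ) - s / a)) ^ 3 := by
  sorry

/-! ### The composition (landed glue `tapLeakBound_of_mixedTapBound_of_kickCone`, p126684) -/

/-- **COMPOSITION.** The two stubs imply the crux `TapLeakBound`, by name: MixedTapBound (`stub_mixedTap_of`, from stub PTB) gives H1 via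
the landed `boundaryHermiteRegularity_of_mixedTapBound`, C′ is `stub_kickCone`, and the landed glue
`tapLeakBound_of_hermite_of_kickCone` does the rest (all packaged in `tapLeakBound_of_mixedTapBound_of_kickCone`; the
route-vocabulary `let`s and `gibbsWeight` agree definitionally). [folklore] -/
theorem TapLeakBound_of : TapLeakBound :=
  tapLeakBound_of_mixedTapBound_of_kickCone stub_mixedTap_of stub_kickCone

end Summit.AtomisticToContinuum.FouriersLaw.Theorems.OddSectorIrreversibility.TapLeak

end
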